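import Summits.Ventures.PercRepro.S2CobasisCoreSix

/-!
# PercRepro — S2: THE CELLS `(20, 6)` AND `(19, 6)` BY THE COBASIS LEVER (p7, gen 6; sub-claim S2)

The cell inequalities of `ThmN.c025_core_five_cobasis_six_cell` at `p = 20` (slack `9/1024`: polynomial side
`≤ 927.2/1024` at the worst `s = 12`, tail `8.9/1024`) and `p = 19` (slack `15/1024`: `975.7/1024`, tail `14.7/1024`),
and the cells as theorems: **`c025_core_five_twenty_six`**, **`c025_core_five_nineteen_six`** — the `e`-free core at
level `5`, rank `20` / `19`, corank `6`. Without the lever the cells read `1.0148 + tail` / `1.0680 + tail` (the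
landed count at `s₃ = 12`). Numeral checks. Axioms: standard.
-/

open scoped Matroid

namespace PercRepro

namespace S2
/-- The cell `(20, 6)` with the cobasis lever, polynomial side, for every `s₃ = s ≤ 12`, slack `9/1024`. -/
theorem cellP20C6_poly : ∀ s ∈ Finset.range 13,
    1024 * (((20 + 6).choose 5 : ℚ) - (s : ℚ) * ((20 + 3).choose 2 : ℚ) + ((s.choose 2 : ℕ) : ℚ) +
      ((s * (if 5 ≤ s then (20 + 3).choose 3 - (20 - 1).choose 3 else (20 + 3).choose 3) +
        S1.fourCircuitBound 6 * (20 + 2).choose 2 + (6 + 4).choose 5 * (20 + 1) + (6 + 5).choose 6 : ℕ) : ℚ)) ≤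
      ((1024 - 9 : ℕ) : ℚ) * 2 ^ (6 - 5) * ((20 + 5).choose 5 : ℚ) := by
  intro s hs
  rw [Finset.mem_range] at hs
  interval_cases s <;> norm_num [Nat.choose, S1.fourCircuitBound, S1.perPointBound]

/-- The cell `(20, 6)`, tail side (S2SharpCoreXQI's at `d = 6`), slack `9/1024` (`n = 26`). -/
theorem cellP20C6_tail : 1024 * ((((20 + 6).choose 4 : ℚ) +
      (∑ j ∈ Finset.range 6, (Nat.choose (min 5 ((6 + 3) / 2 + 1 - 2)) j : ℚ) / (((j + 1) + 3 * (j + 1).choose 2 : ℕ) : ℚ)) *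
        ((((6 * 6 + 6 - 3 * 6) / 2) * (20 + 6 - 3).choose 2 + S1.fourCircuitBound 6 * (20 + 6 - 4) + (6 + 4).choose 5 : ℕ) : ℚ) +
      ((∑ j ∈ Finset.range 6, (Nat.choose 5 j : ℚ) / (((j + 1) + 3 * (j + 1).choose 2 : ℕ) : ℚ)) -
        (∑ j ∈ Finset.range 6, (Nat.choose (min 5 ((6 + 3) / 2 + 1 - 2)) j : ℚ) / (((j + 1) + 3 * (j + 1).choose 2 : ℕ) : ℚ))) *
        ((10 : ℕ).choose 5 : ℚ)) +
      (((20 + 6).choose 3 * 2 ^ 3 + (20 + 6).choose 2 * 2 + (20 + 6) + 1 : ℕ) : ℚ) +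
      (((20 + 6).choose 5 : ℚ) + (∑ j ∈ Finset.range (6), (Nat.choose (min 13 ((6 + 6) / 2 + 1 - 2)) j : ℚ) / (((j + 1) + 3 * (j + 1).choose 2 : ℕ) : ℚ)) * ((((6 * 6 + 6 - 3 * 6) / 2) * (20 + 6 - 3).choose 3 + S1.fourCircuitBound 6 * (20 + 6 - 4).choose 2 + (6 + 4).choose 5 * (20 + 6 - 5) + (6 + 5).choose 6 : ℕ) : ℚ) +
        ((∑ j ∈ Finset.range (6), (Nat.choose (min 19 (5 + 6) - 6) j : ℚ) / (((j + 1) + 3 * (j + 1).choose 2 : ℕ) : ℚ)) - (∑ j ∈ Finset.range (6), (Nat.choose (min 13 ((6 + 6) / 2 + 1 - 2)) j : ℚ) / (((j + 1) + 3 * (j + 1).choose 2 : ℕ) : ℚ))) *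
        ((min 19 (5 + 6)).choose 6 : ℚ)) +
      ((∑ j ∈ Finset.range (6 + 1), (20 + 6).choose j : ℕ) : ℚ)) ≤ (9 : ℚ) * 2 ^ (20 + 6) := by
  have hs3 : (∑ j ∈ Finset.range 6, (Nat.choose (min 5 ((6 + 3) / 2 + 1 - 2)) j : ℚ) / (((j + 1) + 3 * (j + 1).choose 2 : ℕ) : ℚ)) = 417 / 220 := by
    norm_num [Finset.sum_range_succ, Nat.choose]
  have hs5 : (∑ j ∈ Finset.range 6, (Nat.choose 5 j : ℚ) / (((j + 1) + 3 * (j + 1).choose 2 : ℕ) : ℚ)) = 9033 / 2618 := by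
    norm_num [Finset.sum_range_succ, Nat.choose]
  have hsm : (∑ j ∈ Finset.range 6, (Nat.choose (min 13 ((6 + 6) / 2 + 1 - 2)) j : ℚ) / (((j + 1) + 3 * (j + 1).choose 2 : ℕ) : ℚ)) = 9033 / 2618 := by
    norm_num [Finset.sum_range_succ, Nat.choose]
  have hsg : (∑ j ∈ Finset.range 6, (Nat.choose (min 19 (5 + 6) - 6) j : ℚ) / (((j + 1) + 3 * (j + 1).choose 2 : ℕ) : ℚ)) = 9033 / 2618 := by
    norm_num [Finset.sum_range_succ, Nat.choose]
  rw [hs3, hs5, hsm, hsg]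
  simp only [Finset.sum_range_succ, Finset.sum_range_zero]
  norm_num [Nat.choose, S1.fourCircuitBound, S1.perPointBound]

/-- The cell `(19, 6)` with the cobasis lever, polynomial side, for every `s₃ = s ≤ 12`, slack `15/1024`. -/
theorem cellP19C6_poly : ∀ s ∈ Finset.range 13,
    1024 * (((19 + 6).choose 5 : ℚ) - (s : ℚ) * ((19 + 3).choose 2 : ℚ) + ((s.choose 2 : ℕ) : ℚ) +
      ((s * (if 5 ≤ s then (19 + 3).choose 3 - (19 - 1).choose 3 else (19 + 3).choose 3) +
        S1.fourCircuitBound 6 * (19 + 2).choose 2 + (6 + 4).choose 5 * (19 + 1) + (6 + 5).choose 6 : ℕ) : ℚ)) ≤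
      ((1024 - 15 : ℕ) : ℚ) * 2 ^ (6 - 5) * ((19 + 5).choose 5 : ℚ) := by
  intro s hs
  rw [Finset.mem_range] at hs
  interval_cases s <;> norm_num [Nat.choose, S1.fourCircuitBound, S1.perPointBound]

/-- The cell `(19, 6)`, tail side (S2SharpCoreXQI's at `d = 6`), slack `15/1024` (`n = 25`). -/
theorem cellP19C6_tail : 1024 * ((((19 + 6).choose 4 : ℚ) +
      (∑ j ∈ Finset.range 6, (Nat.choose (min 5 ((6 + 3) / 2 + 1 - 2)) j : ℚ) / (((j + 1) + 3 * (j + 1).choose 2 : ℕ) : ℚ)) *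
        ((((6 * 6 + 6 - 3 * 6) / 2) * (19 + 6 - 3).choose 2 + S1.fourCircuitBound 6 * (19 + 6 - 4) + (6 + 4).choose 5 : ℕ) : ℚ) +
      ((∑ j ∈ Finset.range 6, (Nat.choose 5 j : ℚ) / (((j + 1) + 3 * (j + 1).choose 2 : ℕ) : ℚ)) -
        (∑ j ∈ Finset.range 6, (Nat.choose (min 5 ((6 + 3) / 2 + 1 - 2)) j : ℚ) / (((j + 1) + 3 * (j + 1).choose 2 : ℕ) : ℚ))) *
        ((10 : ℕ).choose 5 : ℚ)) +
      (((19 + 6).choose 3 * 2 ^ 3 + (19 + 6).choose 2 * 2 + (19 + 6) + 1 : ℕ) : ℚ) +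
      (((19 + 6).choose 5 : ℚ) + (∑ j ∈ Finset.range (6), (Nat.choose (min 13 ((6 + 6) / 2 + 1 - 2)) j : ℚ) / (((j + 1) + 3 * (j + 1).choose 2 : ℕ) : ℚ)) * ((((6 * 6 + 6 - 3 * 6) / 2) * (19 + 6 - 3).choose 3 + S1.fourCircuitBound 6 * (19 + 6 - 4).choose 2 + (6 + 4).choose 5 * (19 + 6 - 5) + (6 + 5).choose 6 : ℕ) : ℚ) +
        ((∑ j ∈ Finset.range (6), (Nat.choose (min 19 (5 + 6) - 6) j : ℚ) / (((j + 1) + 3 * (j + 1).choose 2 : ℕ) : ℚ)) - (∑ j ∈ Finset.range (6), (Nat.choose (min 13 ((6 + 6) / 2 + 1 - 2)) j : ℚ) / (((j + 1) + 3 * (j + 1).choose 2 : ℕ) : ℚ))) *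
        ((min 19 (5 + 6)).choose 6 : ℚ)) +
      ((∑ j ∈ Finset.range (6 + 1), (19 + 6).choose j : ℕ) : ℚ)) ≤ (15 : ℚ) * 2 ^ (19 + 6) := by
  have hs3 : (∑ j ∈ Finset.range 6, (Nat.choose (min 5 ((6 + 3) / 2 + 1 - 2)) j : ℚ) / (((j + 1) + 3 * (j + 1).choose 2 : ℕ) : ℚ)) = 417 / 220 := by
    norm_num [Finset.sum_range_succ, Nat.choose]
  have hs5 : (∑ j ∈ Finset.range 6, (Nat.choose 5 j : ℚ) / (((j + 1) + 3 * (j + 1).choose 2 : ℕ) : ℚ)) = 9033 / 2618 := by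
    norm_num [Finset.sum_range_succ, Nat.choose]
  have hsm : (∑ j ∈ Finset.range 6, (Nat.choose (min 13 ((6 + 6) / 2 + 1 - 2)) j : ℚ) / (((j + 1) + 3 * (j + 1).choose 2 : ℕ) : ℚ)) = 9033 / 2618 := by
    norm_num [Finset.sum_range_succ, Nat.choose]
  have hsg : (∑ j ∈ Finset.range 6, (Nat.choose (min 19 (5 + 6) - 6) j : ℚ) / (((j + 1) + 3 * (j + 1).choose 2 : ℕ) : ℚ)) = 9033 / 2618 := by
    norm_num [Finset.sum_range_succ, Nat.choose]
  rw [hs3, hs5, hsm, hsg]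
  simp only [Finset.sum_range_succ, Finset.sum_range_zero]
  norm_num [Nat.choose, S1.fourCircuitBound, S1.perPointBound]

end S2

namespace ThmN

open Set

variable {α : Type}
/-- **The `e`-free core at level `5`, rank `20`, corank `6`** — closed by the cobasis lever (slack `9/1024`). -/
theorem c025_core_five_twenty_six (M : Matroid α) [M.Finite]
    (hR : M.eRank = ((20 : ℕ) : ℕ∞)) (hn : M.E.ncard = 20 + 6)
    (hfree : ∀ e ∈ M.E, ∃ A ⊆ M.E \ {e}, e ∉ M.closure A ∧ e ∉ M.closure ((M.E \ {e}) \ A)) :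
    RLS M 20 5 :=
  c025_core_five_cobasis_six_cell M 20 (by norm_num) hR hn hfree
    ⟨9, by norm_num, S2.cellP20C6_poly, S2.cellP20C6_tail⟩

/-- **The `e`-free core at level `5`, rank `19`, corank `6`** — closed by the cobasis lever (slack `15/1024`). -/
theorem c025_core_five_nineteen_six (M : Matroid α) [M.Finite]
    (hR : M.eRank = ((19 : ℕ) : ℕ∞)) (hn : M.E.ncard = 19 + 6)
    (hfree : ∀ e ∈ M.E, ∃ A ⊆ M.E \ {e}, e ∉ M.closure A ∧ e ∉ M.closure ((M.E \ {e}) \ A)) :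
    RLS M 19 5 :=
  c025_core_five_cobasis_six_cell M 19 (by norm_num) hR hn hfree
    ⟨15, by norm_num, S2.cellP19C6_poly, S2.cellP19C6_tail⟩


end ThmN

end PercRepro
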